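import Summits.BirchSwinnertonDyer.BirchSwinnertonDyer.Theorems.AdditiveBranchIMCGordTwoRankOneHeegnerKolyvaginSelfTwistFrame
import Summits.BirchSwinnertonDyer.Rank1Residual.Partition.CornersFlagFree
import Summits.BirchSwinnertonDyer.Rank1Residual.Additive.TwistRamTransport
import HarnessLib

/-!
# Route `AdditiveBranchIMC` (rung K1), crux `GordTwoRankOne` (item 19358): the Heegner–Kolyvagin road,
# Part 23a — the self-twist frame with `BSD(V,p)` DISCHARGED FLAG-FREE under (ram)
# (cell `bsd-addord`, second prover lane `bsd-addord-k1-c3x`, gen 6; `--supports` only)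

HONEST FRAMING. THEOREMS ONLY: no definition, no new named fact, no `sorry`; nothing is booked; crux 19358
stays OPEN at class level; BSD is not proved by any of this. Part 21c's `bsdp_of_selfTwistFrame` (gen 5)
gives `BSD(E,p)` on the self-twist frame `K = ℚ(√−p)` (`p ≡ 3 (mod 4)`, `E = Cd • V^{(d_K)}`, `V` the GOOD
ordinary `p*`-twist, parametrised) from PUBLISHED binders, the displayed JSW inequality `hL` for
`(V, ℚ(√−p))`, AND the rank-zero `p`-part `hBSDV : BSDp V p` of the good twist — which in the tree is
either Burungale–Castella–Skinner 2025 Cor. 1.3.1 (PUB* flag, `bsdp_twist_pStar_of_classX4_of_surj`) or,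
under (ram), Skinner 2016 Thm. C FLAG-FREE (`bsdp_goodOrd_rankZero_of_irr_of_ram`). Gen 5 left the
(ram)-transport as a successor item (memo `ROAD-KOLYVAGIN-19358-g5.md` §5); THIS FILE does it:
(ram) for `E` — a multiplicative prime `ℓ ≠ p` of `E` with `p ∤ ord_ℓ Δ_min(E)` (`Rank1Residual.Ram W p`)
— transports to `V` along the `p*`-twist (`Additive.ram_of_twist_pStar`: `ℓ ≠ p` is unramified in
`ℚ(√p*)`, so reduction type and `ord_ℓ Δ_min` agree), irreducibility of `V[p]` comes from `ρ̄_{E,p}` onto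
read on `V` (`E[p] ≅ V[p] ⊗ χ_{d_K}`), `L(V,1) ≠ 0` gives `r_an(V) = 0`, and Skinner's theorem (`hSk`,
REFEREED, no flag) supplies `BSDp V p`. So on the self-twist rows with a (ram) witness, `BSD(E,p)` ⟸
PUBLISHED binders (`hSk hGZ hKo hKB hGZK hmod`) + the ONE displayed input `hL` (the anticyclotomic
'Selmer ≥ L' inequality for the good ordinary `V` over `ℚ(√−p)`, support item 23086's shape) + the data
`p ∤ ∏c(V)·∏c(E)`. No PUB* flag anywhere.

THEOREM `bsdp_of_selfTwistFrame_of_ram` (pointwise, explicit frame; `p ≡ 3 (mod 4)` explicit as `hp4`).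

References: [Skinner2016PacificMC] Thm. C (§1); [JetchevSkinnerWan2017] §7.4; [KolyvaginEulerSystems1990]
Thm. A; [McCallumLMS1991] §1; [SilvermanAEC2009] VII.1 Prop. 1.3(b), X.5 Cor. 5.4; [Miller2011LMS] Def. 1.1.
-/

set_option autoImplicit false
set_option linter.dupNamespace false
noncomputable section

open scoped Classical NumberField
open WeierstrassCurve NumberField IsDedekindDomain
  Literature.NumberTheory.EllipticCurves Literature.NumberTheory.EllipticCurves.ModularForms
  Literature.NumberTheory.EllipticCurves.Rank1Residual
  Literature.NumberTheory.EllipticCurves.Rank1Residual.Typed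
  Summit.BirchSwinnertonDyer.Rank1Residual
  Summit.BirchSwinnertonDyer.Rank1Residual.Additive

namespace Summit.BirchSwinnertonDyer.BirchSwinnertonDyer.Theorems.AdditiveBranchIMCGordTwoRankOne.HeegnerKolyvagin

/-! ### §12 The self-twist frame under (ram): `BSD(V,p)` from Skinner 2016 Thm. C, flag-free -/

/-- **(ram) and surjectivity transport from `E` to its good `p*`-twist `V` on the self-twist frame**: for
`E = Cd • V^{(d_K)}` with `d_K = −p`, `p ≡ 3 (mod 4)`: `Ram W p → Ram V p` (`Additive.ram_of_twist_pStar`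
with `d = −p = 4k + 1`, `k = −(p+1)/4`) and `ρ̄_{E,p}` onto `→ ρ̄_{V,p}` onto (`E[p] ≅ V[p] ⊗ χ_{d_K}`,
`GaloisImage.hasSurjectiveModNGaloisRep_pow_iff_of_model_twist` at `n = 1`).
[cite: SilvermanAEC2009, VII.1 Prop. 1.3(b) and X.5 Cor. 5.4] -/
theorem ram_and_surj_pStarTwist_of_selfTwistFrame
    (W : WeierstrassCurve ℚ) [W.IsElliptic] [W.IsGloballyMinimal] (p : ℕ) [Fact p.Prime] (hp4 : p % 4 = 3)
    (V : WeierstrassCurve ℚ) [V.IsElliptic] [V.IsGloballyMinimal]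
    (K : Type) [Field K] [NumberField K] (hdisc : NumberField.discr K = -(p : ℤ))
    (Cd : VariableChange ℚ) (hCd : Cd • V.quadraticTwist (NumberField.discr K : ℚ) = W)
    (hsurj : W.HasSurjectiveModNGaloisRep p) (hram : Ram W p) :
    Ram V p ∧ V.HasSurjectiveModNGaloisRep p := by
  have hD0 : (NumberField.discr K : ℚ) ≠ 0 := by exact_mod_cast NumberField.discr_ne_zero K
  have hCd' : Cd • V.quadraticTwist ((-(p : ℤ) : ℤ) : ℚ) = W := by
    have : ((-(p : ℤ) : ℤ) : ℚ) = (NumberField.discr K : ℚ) := by rw [hdisc]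
    rw [this]; exact hCd
  refine ⟨ram_of_twist_pStar p V (d := -(p : ℤ)) (k := -(((p + 1) / 4 : ℕ) : ℤ)) (by omega) (Or.inr rfl)
    Cd hCd' hram, ?_⟩
  have h := GaloisImage.hasSurjectiveModNGaloisRep_pow_iff_of_model_twist V p hD0 ⟨Cd, hCd⟩ 1
  rw [pow_one] at h
  exact h.mp hsurj

/-- **`BSD(E,p)` ON THE SELF-TWIST FRAME, (ram) VERSION — `BSD(V,p)` discharged FLAG-FREE.** Data as in
Part 21c's `bsdp_of_selfTwistFrame`: `E = W = Cd • V^{(d_K)}` globally minimal of analytic rank `1`,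
`K` imaginary quadratic with `d_K = −p` (`p ≡ 3 (mod 4)`, `hp4`), `p ∤ #𝓞_K^×`, `V` globally minimal, GOOD
ORDINARY at `p` (`hgoV : GoodOrd V p`) with `L(V,1) ≠ 0`, `ρ̄_{E,p}` onto, the Heegner hypothesis for
`(N, K)`, a parametrisation datum `Dt` of `V` at level `N` with `p ∤ c(Dt)` and its Heegner point `P ∈ V(K)`,
`p ∤ ∏c(V)·∏c(E)`; NEW: a (ram) witness for `E` (`hram : Ram W p` — a multiplicative prime `ℓ ≠ p` of `E`
with `p ∤ ord_ℓ Δ_min(E)`). PUBLISHED binders: Skinner 2016 Thm. C (`hSk`, REFEREED, flag-free), Gross–Zagier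
(`hGZ`), Kolyvagin (`hKo`, `hKB`), GZK (`hGZK`), modularity (`hmod`). DISPLAYED: the JSW inequality `hL` for
`(V, ℚ(√−p))` (item 23086's shape, unit term not needed here since `p ∤ #𝓞_K^×`). CONCLUSION: `BSDp W p`.
Chain: (ram) and surjectivity transport to `V` (`ram_and_surj_pStarTwist_of_selfTwistFrame`), `V[p]`
irreducible, `r_an(V) = 0` from `L(V,1) ≠ 0`, so `BSDp V p` by `bsdp_goodOrd_rankZero_of_irr_of_ram`
(Skinner 2016 Thm. C); then Part 21c's `bsdp_of_selfTwistFrame`. No PUB* input, no `p`-adic height, no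
additive prime in any hypothesis of the analytic inputs. Pointwise; nothing booked.
[cite: Skinner2016PacificMC, Thm. C (§1)] [cite: JetchevSkinnerWan2017, §7.4 (pp. 29–31)]
[cite: McCallumLMS1991, §1 Theorem (Kolyvagin), p. 296] [cite: Miller2011LMS, Def. 1.1] -/
theorem bsdp_of_selfTwistFrame_of_ram
    (hSk : Skinner2016.thmC_padicValRat_bsd_rank_zero)
    (hGZK : rank_eq_analyticRank_of_analyticRank_le_one) (hmod : hasEntireLFunction_rat)
    (W : WeierstrassCurve ℚ) [W.IsElliptic] [W.IsGloballyMinimal] (p : ℕ) [Fact p.Prime] (hp4 : p % 4 = 3)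
    (hr : W.analyticRank = 1) (hsurj : W.HasSurjectiveModNGaloisRep p) (hram : Ram W p)
    (V : WeierstrassCurve ℚ) [V.IsElliptic] [V.IsGloballyMinimal] (N : ℕ) [NeZero N]
    (K : Type) [Field K] [NumberField K] (hK : IsImaginaryQuadratic K)
    (hdisc : NumberField.discr K = -(p : ℤ)) (hμ : ¬ p ∣ Units.torsionOrder K)
    (Cd : VariableChange ℚ) (hCd : Cd • V.quadraticTwist (NumberField.discr K : ℚ) = W)
    (hgoV : GoodOrd V p) (hLV : V.entireLFunction 1 ≠ 0)
    (hHN : SatisfiesHeegnerHypothesis N K) (hGZ : gross_zagier N V K) (hKo : kolyvagin N V K)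
    (hKB : Kolyvagin1990_padicValNat_card_sha_le N V K)
    (Dt : ModularParametrizationData V N) (H : HeegnerDatum N (NumberField.discr K)) (ι : K →+* ℂ)
    (P : (V.baseChange K).toAffine.Point)
    (hP : WeierstrassCurve.Affine.Point.map ι.toRatAlgHom P = heegnerPointComplex Dt H) (hc : ¬ (p : ℤ) ∣ Dt.c)
    (htamV : ¬ p ∣ V.tamagawaProduct) (htamW : ¬ p ∣ W.tamagawaProduct)
    (hL : Finite (V.baseChange K).sha →
      (2 * padicValNat p (AddSubgroup.zmultiples P).index : ℤ) ≤
        padicValNat p (V.baseChange K).shaOrder + padicValNat p V.tamagawaProduct +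
          padicValNat p W.tamagawaProduct) :
    BSDp W p := by
  have hp2 : p ≠ 2 := by omega
  obtain ⟨hramV, hsurjV⟩ := ram_and_surj_pStarTwist_of_selfTwistFrame W p hp4 V K hdisc Cd hCd hsurj hram
  have hirrV : Irr V p := hasIrreducibleModPGaloisRep_of_hasSurjectiveModNGaloisRep V p hsurjV
  have hr0 : V.analyticRank = 0 := (V.analyticRank_eq_zero_iff_holds (hmod V)).2 hLV
  have hBSDV : BSDp V p := bsdp_goodOrd_rankZero_of_irr_of_ram hSk hmod hGZK hr0 hp2 hgoV hirrV hramV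
  exact bsdp_of_selfTwistFrame hGZK hmod W p hp2 hr hsurj V N K hK hdisc hμ Cd hCd hgoV.1 hLV hBSDV hHN hGZ hKo
    hKB Dt H ι P hP hc htamV htamW hL

end Summit.BirchSwinnertonDyer.BirchSwinnertonDyer.Theorems.AdditiveBranchIMCGordTwoRankOne.HeegnerKolyvagin

end
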